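import Summits.QuantumFields.YangMills.Theorems.AlphaInputsT3ACv3OneBlockLiftTube
import Summits.QuantumFields.YangMills.Theorems.AlphaInputsT3ACv3LinearLiftMatrixRegion
import Summits.QuantumFields.YangMills.Theorems.AlphaInputsT3ACv3LinearLiftSupport
import Summits.QuantumFields.YangMills.Theorems.AlphaInputsT3ACv3AvgIterLocality
import HarnessLib

/-!
# `AlphaInputsT3ACv3OneBlockLift` — (r1-ob) ★★ THE ONE-BLOCK LIFT IS AN EXACT RIGHT INVERSE OF THE `k`-FOLD LINEAR (0.4) AVERAGE: `linAvgIter k (obLift A) = A` — lane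
# `pub-balaban3d` ∕ cell `ym3-torus`, seat alpha-2 (g6); kernel of record for the regional Newton route (★★OWNER g25 03:01:17Z, LEAD ★w1-19936 g2 03:02:18Z)

WHY (`…v3OneBlockLiftDefs`, HOME `pub-balaban3d/ONE-BLOCK-KERNEL-alpha2-g6.md`).  The elementary kernel `e_{(y,α)} = e⁰ + Ψ_k(e⁰)(y)·dχ_y` lives on the bonds issuing from ONE
block; this file proves it is an EXACT lift of the coarse elementary one-form `δ_{(y,α)}`, hence `obLift` is a right inverse of `linAvgIter k` on the whole torus.  Route:
`linAvgIter k a = M^k a − d(Ψ_k a)` (★w2 `LinearLiftGauge.linAvgIter_eq_segIter_sub`), `M^k = (L^k)^{−3}·tubeSum` (★w3 `segIter_eq_tubeSum`); the TUBE SUMS of the product form are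
`(L^k)³·δ` by two 1D facts (`Σ h = 1`, `Σ G = 0` of `…v3AbelianShapes1D`, and the mean-one tent) — §1–§2; the coboundary `Ψ_k(e⁰)` vanishes off the block `y` by the one-block
locality of `Ψ` (★w2 `psiIter_congr_block`) — §3; the bump `χ_y` is `1` at the centre of `B^k(y)` and `0` at every other centre, so `linAvgIter k (dχ_y) = d(χ_y ∘ toFine k) = dδ_y`
(★w2 `linAvgIter_dgrad`) cancels it — §4; assembly by linearity — §5.
WHAT (the tube sums `tubeSum_e0` are in the sibling `…v3OneBlockLiftTube`).  §3 `psiIter_zero`, `e0_eq_zero_of_ne`, `psiIter_e0_of_ne`; §4 `coarsen_toFine'`, `chiB_toFine_self`,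
`chiB_toFine_of_ne`, `chiB_comp_toFine`; §5 `linAvgIter_finset_sum`, `dgrad_smul`, ★ `linAvgIter_obKernel`, ★★ `linAvgIter_obLift`, `linAvgIter_obLiftL`.
HONEST FRAMING.  Kernel algebra of explicit lattice functions; count-neutral helper toward the (FL)∕KIN row `hLift` of R3 2′∕2′χ (`stub_laneRecordsV3`, items 19935∕19936 — NOT
proved here); registry untouched; nothing about d = 4, the continuum limit, or a mass gap; YM₃ on T³ is rung R3, not the Clay problem.

References: T. Bałaban, Commun. Math. Phys. 109 (1987) 249–301 [Balaban1987RG1] ((0.3) p.252, (0.4)+(0.11) p.253); CMP 102 (1985) 277–309 [Balaban1985Variational] ((8) p.279).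
-/

set_option autoImplicit false

noncomputable section

namespace Summit.QuantumFields.YangMills.Theorems.AbelianEML.OneBlock

open scoped BigOperators
open Literature.MathematicalPhysics.QuantumFieldTheory.Balaban1983to89
open Literature.MathematicalPhysics.QuantumFieldTheory.Balaban1983to89.T3ContinuumYM3Torus
open Literature.MathematicalPhysics.QuantumFieldTheory.Balaban1983to89.B10Eq38TorusDomains (toFine)
open Literature.MathematicalPhysics.QuantumFieldTheory.Balaban1983to89.B10Eq47AxialChi (shiftN shiftN_zero shiftN_succ)
open Literature.MathematicalPhysics.QuantumFieldTheory.Balaban1983to89.BlockAveragingEMLProp2 (shiftN_apply)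
open Literature.MathematicalPhysics.QuantumFieldTheory.Balaban1983to89.B5Eq118OneStroke (iterBlockOf)
open Summit.QuantumFields.YangMills.Theorems.AbelianEML.Shapes1D
open Summit.QuantumFields.YangMills.Theorems.AbelianEML.Tensor (rho form3 N0 nc sizes le_standing coarsen_eq_iff val_bsite3 rho_tube_ne tubeSum_form3 rho_shift_mod)
open Summit.QuantumFields.YangMills.Theorems.LinearLiftGauge (dgrad psiIter segIter linAvgIter_eq_segIter_sub linAvgIter_dgrad stairMean_sub ptMean)
open Summit.QuantumFields.YangMills.Theorems.LinearLiftMatrix (linAvgIter_smul segIter_eq_tubeSum)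
open Summit.QuantumFields.YangMills.Theorems.LinearLiftSpread (psiIter_congr_block iterBlockOf_toFine)
open Summit.QuantumFields.YangMills.Theorems.AvgIterLocality (coarsen_eq_iterBlockOf)
open Summit.QuantumFields.Balaban3D.Carriers (coarsen)

/-! ## §3 The coboundary potential of the product form vanishes off its block -/

section Psi

variable {P : Params}

/-- `Ψ_s(0) = 0`. [folklore] -/
theorem psiIter_zero : ∀ (s : ℕ) (y : Site P s), psiIter s (0 : PBond P 0 → ℝ) y = 0
  | 0, _ => rfl
  | s + 1, y => by
    show ptMean (psiIter s (0 : PBond P 0 → ℝ)) y + stairMean (linAvgIter s (0 : PBond P 0 → ℝ)) y = 0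
    have h0 : psiIter s (0 : PBond P 0 → ℝ) = fun _ => 0 := funext (psiIter_zero s)
    have hl : linAvgIter s (0 : PBond P 0 → ℝ) = 0 := by
      have := linAvgIter_smul (P := P) 0 s 0
      simpa using this
    have hs : stairMean (0 : PBond P s → ℝ) y = 0 := by
      have := stairMean_sub (0 : PBond P s → ℝ) 0 y
      simpa using this
    rw [h0, hl, hs, add_zero]
    simp [ptMean]

variable {F : T3Family} {K k : ℕ}

/-- The product form vanishes on every bond whose source is outside `B^k(y)`. [cite: Balaban1985Variational, (8) p.279] -/
theorem e0_eq_zero_of_ne (hk : k ≤ K) (y : Site (F.P K) k) (α : Fin 3) (b : PBond (F.P K) 0) (h : coarsen k b.src ≠ y) : e0 F K k y α b = 0 := by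
  unfold e0 form3
  by_cases hd : b.dir = α
  · simp only [hd, if_true]
    have hne : ¬ ∀ i, (b.src i).val / F.L ^ k = (y i).val := fun hcon => h ((coarsen_eq_iff hk b.src y).mpr hcon)
    obtain ⟨i, hi⟩ := not_forall.mp hne
    by_cases hiα : i = α
    · have h0 : hS false (F.L ^ k) (N0 F K) (rho y b.src α) = 0 := by
        rw [← hiα]; exact hosted_eq_zero_of_ne hk _ y b.src i hi
      rw [h0, zero_mul]
    · have h0 : tS (F.L ^ k) (N0 F K) (rho y b.src i) = 0 := hosted_eq_zero_of_ne hk _ y b.src i hi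
      have hprod : ∏ j ∈ Finset.univ.erase α, tS (F.L ^ k) (N0 F K) (rho y b.src j) = 0 :=
        Finset.prod_eq_zero (Finset.mem_erase.mpr ⟨hiα, Finset.mem_univ i⟩) h0
      rw [hprod, mul_zero]
  · have hd3 : ¬ (@Eq (Fin 3) b.dir α) := fun h => hd h
    simp only [hd3, if_false]

/-- **THE COBOUNDARY POTENTIAL OF `e⁰_{(y,α)}` VANISHES AT EVERY OTHER BLOCK** (one-block locality of `Ψ_k`). [cite: Balaban1987RG1, (0.4)+(0.11) p.253] -/
theorem psiIter_e0_of_ne (hk : k ≤ K) (y y' : Site (F.P K) k) (α : Fin 3) (h : y' ≠ y) : psiIter k (e0 F K k y α) y' = 0 := by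
  rw [psiIter_congr_block (e0 F K k y α) 0 k (le_standing hk) y' fun b hb _ => ?_]
  · exact psiIter_zero k y'
  · have hc : coarsen k b.src = y' := by rw [coarsen_eq_iterBlockOf]; exact hb
    exact e0_eq_zero_of_ne hk y α b (by rw [hc]; exact h)

end Psi

/-! ## §4 The centre bump at the block centres -/

section Chi

variable {F : T3Family} {K k : ℕ}

/-- `coarsen k (toFine k y) = y` (bridge + ★w2's `iterBlockOf_toFine`). [folklore] -/
theorem coarsen_toFine' (hk : k ≤ K) (y : Site (F.P K) k) : coarsen k (toFine k y) = y := by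
  rw [coarsen_eq_iterBlockOf]; exact iterBlockOf_toFine k (le_standing hk) y

/-- **THE BUMP IS `1` AT THE CENTRE OF ITS BLOCK.** [cite: Balaban1987RG1, (0.3) p.252] -/
theorem chiB_toFine_self (hk : k ≤ K) (y : Site (F.P K) k) : chiB F K k y (toFine k y) = 1 := by
  unfold chiB
  refine Finset.prod_eq_one fun i _ => ?_
  have hin : rho y (toFine k y) i % N0 F K < F.L ^ k :=
    (rho_mod_lt_iff hk y _ i).mpr (((coarsen_eq_iff hk _ y).mp (coarsen_toFine' hk y)) i)
  simp only [bumpS, per, ctr]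
  rw [if_pos hin]
  simp [bumpV]

/-- **THE BUMP OF `y` VANISHES AT THE CENTRE OF EVERY OTHER BLOCK** (it is hosted in `B^k(y)`). [cite: Balaban1987RG1, (0.3) p.252] -/
theorem chiB_toFine_of_ne (hk : k ≤ K) (y y' : Site (F.P K) k) (h : y' ≠ y) : chiB F K k y (toFine k y') = 0 := by
  unfold chiB
  have hne : ¬ ∀ i, ((toFine k y') i).val / F.L ^ k = (y i).val := fun hcon =>
    h ((coarsen_toFine' hk y').symm.trans ((coarsen_eq_iff hk _ y).mpr hcon))
  obtain ⟨i, hi⟩ := not_forall.mp hne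
  exact Finset.prod_eq_zero (Finset.mem_univ i) (hosted_eq_zero_of_ne hk _ y _ i hi)

/-- The bump read at the block centres is the indicator of `y`. [folklore] -/
theorem chiB_comp_toFine (hk : k ≤ K) (y : Site (F.P K) k) : (chiB F K k y) ∘ toFine k = fun y' => if y' = y then 1 else 0 := by
  funext y'
  by_cases h : y' = y
  · subst h; simp only [Function.comp, if_true]; exact chiB_toFine_self hk y'
  · simp only [Function.comp, h, if_false]; exact chiB_toFine_of_ne hk y y' h

end Chi

/-! ## §5 Exactness -/

section Exact

variable {F : T3Family} {K k : ℕ}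

/-- `linAvgIter` of a finite sum. [folklore] -/
theorem linAvgIter_finset_sum {P : Params} {ι : Type*} (s : Finset ι) (a : ι → PBond P 0 → ℝ) (m : ℕ) :
    linAvgIter m (∑ i ∈ s, a i) = ∑ i ∈ s, linAvgIter m (a i) := by
  classical
  induction s using Finset.induction_on with
  | empty =>
    simp only [Finset.sum_empty]
    have := linAvgIter_smul (P := P) 0 m 0
    simpa using this
  | insert j s hj ih => rw [Finset.sum_insert hj, Finset.sum_insert hj, linAvgIter_add, ih]

/-- `dgrad` is homogeneous. [folklore] -/
theorem dgrad_smul {P : Params} {j : ℕ} (r : ℝ) (g : Site P j → ℝ) : dgrad (r • g) = r • dgrad g := by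
  funext b; simp only [dgrad, Pi.smul_apply, smul_eq_mul]; ring

open scoped Classical in
/-- **★ THE ELEMENTARY KERNEL IS AN EXACT LIFT OF `δ_{(y,α)}`**: `linAvgIter k e_{(y,α)} (c) = [c = (y, α)]` on EVERY level-`k` bond (`k ≤ K`, `L^k ≥ 3`).
[cite: Balaban1985Variational, (8) p.279; Balaban1987RG1, (0.4)+(0.11) p.253] -/
theorem linAvgIter_obKernel (hk : k ≤ K) (hn3 : 3 ≤ F.L ^ k) (y : Site (F.P K) k) (α : Fin 3) (c : PBond (F.P K) k) :
    linAvgIter k (obKernel F K k y α) c = if c = ⟨y, α⟩ then 1 else 0 := by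
  set Ψ₀ : ℝ := psiIter k (e0 F K k y α) y with hΨ₀
  -- the kernel as `e⁰ + Ψ₀ • dχ`
  have hker : obKernel F K k y α = e0 F K k y α + Ψ₀ • dgrad (chiB F K k y) := by
    funext b; rfl
  -- the potential is `Ψ₀ • (χ ∘ toFine k)`
  have hpsi : psiIter k (e0 F K k y α) = Ψ₀ • ((chiB F K k y) ∘ toFine k) := by
    funext y'
    rw [chiB_comp_toFine hk y]
    simp only [Pi.smul_apply, smul_eq_mul]
    by_cases h : y' = y
    · rw [h, if_pos rfl, mul_one]
    · rw [if_neg h, mul_zero]; exact psiIter_e0_of_ne hk y y' α h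
  -- the segment means of `e⁰`
  have hseg : segIter k (e0 F K k y α) c = if c = ⟨y, α⟩ then 1 else 0 := by
    rw [segIter_eq_tubeSum k (le_standing hk)]
    obtain ⟨y', μ⟩ := c
    rw [tubeSum_e0 hk hn3 y y' α μ]
    have hL : ((F.L : ℝ) ^ k) ^ 3 ≠ 0 := pow_ne_zero _ (pow_ne_zero _ (by exact_mod_cast (zero_lt_one.trans F.hL.2).ne'))
    split_ifs with h1 h2 h2
    · show (((F.L : ℝ) ^ k) ^ 3)⁻¹ * ((F.L : ℝ) ^ k) ^ 3 = 1
      exact inv_mul_cancel₀ hL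
    · exact absurd (by rw [h1.1, h1.2]) h2
    · simp only [PBond.mk.injEq] at h2
      exact absurd h2 h1
    · rw [mul_zero]
  rw [hker, linAvgIter_add, linAvgIter_smul, linAvgIter_eq_segIter_sub, linAvgIter_dgrad, hpsi, dgrad_smul]
  simp only [Pi.add_apply, Pi.sub_apply, Pi.smul_apply, smul_eq_mul, hseg]
  ring

/-- **★★ THE ONE-BLOCK LIFT IS A RIGHT INVERSE OF THE `k`-FOLD LINEAR (0.4) AVERAGE**: `linAvgIter k (obLift A) = A` on the whole torus (`k ≤ K`, `L^k ≥ 3`).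
[cite: Balaban1985Variational, (3)+(8) pp.278–279; Balaban1987RG1, (0.11) p.253] -/
theorem linAvgIter_obLift (hk : k ≤ K) (hn3 : 3 ≤ F.L ^ k) (A : PBond (F.P K) k → ℝ) : linAvgIter k (obLift F K k A) = A := by
  classical
  have hsum : obLift F K k A = ∑ c : PBond (F.P K) k, A c • obKernel F K k c.src c.dir := by
    funext b; simp only [obLift, Finset.sum_apply, Pi.smul_apply, smul_eq_mul]
  rw [hsum, linAvgIter_finset_sum]
  funext c'
  simp only [Finset.sum_apply, linAvgIter_smul, Pi.smul_apply, smul_eq_mul, linAvgIter_obKernel hk hn3]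
  have key : ∀ c : PBond (F.P K) k, (A c * if c' = ⟨c.src, c.dir⟩ then (1 : ℝ) else 0) = if c' = c then A c else 0 := by
    intro c
    by_cases h : c' = c
    · subst h; simp
    · rw [if_neg h, if_neg, mul_zero]
      intro e; exact h (by rw [e])
  simp_rw [key]
  rw [Finset.sum_ite_eq Finset.univ c' A, if_pos (Finset.mem_univ _)]

/-- The linear-map form: `linAvgIter k ∘ obLiftL = id`. [cite: Balaban1987RG1, (0.11) p.253] -/
theorem linAvgIter_obLiftL (hk : k ≤ K) (hn3 : 3 ≤ F.L ^ k) (A : PBond (F.P K) k → ℝ) : linAvgIter k (obLiftL F K k A) = A :=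
  linAvgIter_obLift hk hn3 A

end Exact

end Summit.QuantumFields.YangMills.Theorems.AbelianEML.OneBlock

end
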